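import Summits.MatrixMultiplication.MatrixMultiplication.Theorems.FarEdgeDescentTowerDeviation
import HarnessLib

/-!
# Far-edge descent, kernel XXX-C1: the deviation induction for an ARBITRARY certified box

Route `FarEdgeDescent`, special leaf `FiniteSaturation` (stmt-MatrixMultiplication-23739): helper
kernel, THESES-FREE and def-free.  Kernel XXX-B3 (`FarEdgeDescentTowerDynamics.core_bound`) ran the
deviation induction of the clock-`7` full-class crude tower with the fixed box `[43/250, 177/1000]`
(entered at stage `9`, multiplier `≥ 179/100`), giving the order `κ/(1−κ) = 0.4269`,
`κ = log₇ 1.79`.  This file proves the same induction ONCE for every CERTIFIED BOX: data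
`(J, α, β, lo)` with `4/25 ≤ α ≤ β ≤ 19/100`, `1 ≤ lo ≤ 2`, the multiplier certificate
`lo·(1+φ(α)) ≤ 7(1−β)⁶` (so `λ(m) ≥ lo` on `[α,β]`, `λ(m) = 7(1−m)⁶/(1+φ(m))`,
`φ(m) = (1−m)⁷ − (1−2m)⁷`) and box membership `m_j = L_j/r_j ∈ [α, β]` for all `j ≥ J`:
then on every sub-tangent `(s,t)` of `y ↦ ω(1,y,1)` and for every `M` with
`(1−t)·3·7^(J+M) ≤ 7/100` one has `(1/20)^J·((s−1)/5)·lo^M < 1` (`core_bound_of_cert`).  Also the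
box tools: `f`-invariance from the two endpoint inequalities (`f_mem_of_cert`, `ratio_mem_box_of_cert`)
and the multiplier bound (`lambda_ge_of_cert`).  Kernel XXX-C2 turns this into
`RateBeyond θ` for all `θ < log₇ lo/(1 − log₇ lo)` and instantiates the box `[0.1743, 0.1750]`
(`J = 18`, `lo = 91/50`, order `0.4446`); the limit of the method is `0.44861` (`lo → λ(m*) = 1.8269`,
`m* = 0.17461` the fixed point of `f`).

References: Pan 1984 (LNCS 179) §17, Thm. 17.1; Lotti–Romani 1983, Thm. 3.1, Prop. 4.1.
-/

set_option linter.dupNamespace false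

noncomputable section

open scoped BigOperators

namespace Summit.MatrixMultiplication.MatrixMultiplication.Theorems.FarEdgeDescentTowerBox

open Literature.Computability.AlgebraicComplexity
open Summit.MatrixMultiplication.MatrixMultiplication.Theorems.FarEdgeDescentTowerRatio
open Summit.MatrixMultiplication.MatrixMultiplication.Theorems.FarEdgeDescentTowerDeviation

variable (K : Type) [Field K]

/-! ## §1 Certified boxes -/

/-- **`f`-invariance from two endpoint inequalities**: if `[α,β] ⊆ [4/25, 19/100]`,
`α(1+φ(β)) ≤ φ(β)` and `φ(α) ≤ β(1+φ(α))`, then `f([α,β]) ⊆ [α,β]`. [folklore] -/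
theorem f_mem_of_cert {α β m : ℝ} (hα : (4 : ℝ) / 25 ≤ α) (hβ : β ≤ 19 / 100)
    (hc1 : α * (1 + ((1 - β) ^ 7 - (1 - 2 * β) ^ 7)) ≤ (1 - β) ^ 7 - (1 - 2 * β) ^ 7)
    (hc2 : (1 - α) ^ 7 - (1 - 2 * α) ^ 7 ≤ β * (1 + ((1 - α) ^ 7 - (1 - 2 * α) ^ 7)))
    (h1 : α ≤ m) (h2 : m ≤ β) :
    α ≤ ((1 - m) ^ 7 - (1 - 2 * m) ^ 7) / (1 + ((1 - m) ^ 7 - (1 - 2 * m) ^ 7)) ∧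
      ((1 - m) ^ 7 - (1 - 2 * m) ^ 7) / (1 + ((1 - m) ^ 7 - (1 - 2 * m) ^ 7)) ≤ β := by
  have h := f_mem hα h1 h2 hβ
  have hφβ := phi_nonneg (m := β) (by linarith) (by linarith)
  have hφα := phi_nonneg (m := α) (by linarith) (by linarith)
  constructor
  · refine le_trans ?_ h.1
    rw [le_div_iff₀ (by linarith)]
    exact hc1
  · refine le_trans h.2 ?_
    rw [div_le_iff₀ (by linarith)]
    exact hc2

/-- **Multiplier certificate**: `lo(1+φ(α)) ≤ 7(1−β)⁶` gives `lo ≤ λ(m)` on `[α,β]`. [folklore] -/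
theorem lambda_ge_of_cert {α β lo m : ℝ} (hα : (4 : ℝ) / 25 ≤ α) (hβ : β ≤ 19 / 100)
    (hlo0 : 0 ≤ lo) (hlo : lo * (1 + ((1 - α) ^ 7 - (1 - 2 * α) ^ 7)) ≤ 7 * (1 - β) ^ 6)
    (h1 : α ≤ m) (h2 : m ≤ β) :
    lo ≤ 7 * (1 - m) ^ 6 / (1 + ((1 - m) ^ 7 - (1 - 2 * m) ^ 7)) := by
  have hφ := phi_antitone hα h1 (by linarith)
  have hpos : 0 < 1 + ((1 - m) ^ 7 - (1 - 2 * m) ^ 7) := by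
    linarith [phi_nonneg (m := m) (by linarith) (by linarith)]
  have h6 : (1 - β) ^ 6 ≤ (1 - m) ^ 6 := pow_le_pow_left₀ (by linarith) (by linarith) 6
  rw [le_div_iff₀ hpos]
  have : lo * (1 + ((1 - m) ^ 7 - (1 - 2 * m) ^ 7)) ≤ lo * (1 + ((1 - α) ^ 7 - (1 - 2 * α) ^ 7)) :=
    mul_le_mul_of_nonneg_left (by linarith) hlo0
  linarith

section Chain

variable (r Q L : ℕ → ℕ)

/-- **Box membership from a certificate**: once `m_J ∈ [α,β]` for an `f`-invariant certified box,
`m_j ∈ [α,β]` for all `j ≥ J`. [folklore] -/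
theorem ratio_mem_box_of_cert
    (hL : ∀ j, L (j + 1) = (Q j + L j) ^ 7 - Q j ^ 7) (hr : ∀ j, r (j + 1) = r j ^ 7 + L (j + 1))
    (hQ1 : ∀ j, 1 ≤ Q j) (hsum : ∀ j, Q j + 2 * L j = r j) {α β : ℝ} (hα : (4 : ℝ) / 25 ≤ α)
    (hβ : β ≤ 19 / 100)
    (hc1 : α * (1 + ((1 - β) ^ 7 - (1 - 2 * β) ^ 7)) ≤ (1 - β) ^ 7 - (1 - 2 * β) ^ 7)
    (hc2 : (1 - α) ^ 7 - (1 - 2 * α) ^ 7 ≤ β * (1 + ((1 - α) ^ 7 - (1 - 2 * α) ^ 7)))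
    {J : ℕ} (hJ : α ≤ (L J : ℝ) / r J ∧ (L J : ℝ) / r J ≤ β) :
    ∀ j, J ≤ j → α ≤ (L j : ℝ) / r j ∧ (L j : ℝ) / r j ≤ β := by
  intro j hj
  induction j with
  | zero =>
    have : J = 0 := by omega
    subst this
    exact hJ
  | succ j ih =>
    rcases Nat.lt_or_ge j J with hjJ | hjJ
    · have : J = j + 1 := by omega
      subst this
      exact hJ
    · rw [ratio_succ r Q L hL hr hQ1 hsum j]
      exact f_mem_of_cert hα hβ hc1 hc2 (ih hjJ).1 (ih hjJ).2

end Chain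

/-! ## §2 Loss budget with the violation stage `n = J + M` as reference -/

/-- For `j < n` and `u·3·7ⁿ ≤ 7/100`: `u·3·7ʲ ≤ 1/100`. [folklore] -/
theorem deficit_small {u : ℝ} {j n : ℕ} (hjn : j < n) (hu0 : 0 ≤ u)
    (hu : u * (3 * 7 ^ n) ≤ 7 / 100) : u * (3 * 7 ^ j) ≤ 1 / 100 := by
  have h7 : (7 : ℝ) ^ (j + 1) ≤ 7 ^ n := pow_le_pow_right₀ (by norm_num) hjn
  rw [pow_succ] at h7
  nlinarith [pow_nonneg (by norm_num : (0 : ℝ) ≤ 7) j]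

/-- **Loss budget** (`lo ≤ 2`): `lo·((1/5)/7^(n−j)) + 14·(u·3·7ʲ) ≤ (1/5)/7^(n−(j+1))` for `j < n`,
`u·3·7ⁿ ≤ 7/100`. [folklore] -/
theorem loss_budget_two {u lo : ℝ} {j n : ℕ} (hjn : j < n) (hu : u * (3 * 7 ^ n) ≤ 7 / 100)
    (hlo : lo ≤ 2) :
    lo * ((1 : ℝ) / 5 / 7 ^ (n - j)) + 14 * (u * (3 * 7 ^ j)) ≤ (1 : ℝ) / 5 / 7 ^ (n - (j + 1)) := by
  have hX : (0 : ℝ) < 7 ^ (n - (j + 1)) := by positivity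
  have h7n : (7 : ℝ) ^ j * 7 ^ (n - j) = 7 ^ n := by rw [← pow_add, Nat.add_sub_cancel' hjn.le]
  have hsucc : (7 : ℝ) ^ (n - j) = 7 * 7 ^ (n - (j + 1)) := by
    rw [show n - j = (n - (j + 1)) + 1 by omega, pow_succ]; ring
  have key : u * (3 * 7 ^ j) ≤ 7 / 100 / 7 ^ (n - j) := by
    rw [le_div_iff₀ (by positivity)]
    calc u * (3 * 7 ^ j) * 7 ^ (n - j) = u * (3 * (7 ^ j * 7 ^ (n - j))) := by ring
      _ = u * (3 * 7 ^ n) := by rw [h7n]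
      _ ≤ 7 / 100 := hu
  rw [hsucc] at key ⊢
  have h1 : lo * ((1 : ℝ) / 5 / (7 * 7 ^ (n - (j + 1)))) ≤ 2 * ((1 : ℝ) / 5 / (7 * 7 ^ (n - (j + 1)))) :=
    mul_le_mul_of_nonneg_right hlo (by positivity)
  have e : (2 : ℝ) * (1 / 5 / (7 * 7 ^ (n - (j + 1)))) + 14 * (7 / 100 / (7 * 7 ^ (n - (j + 1)))) =
      (2 / 5 / 7 + 14 / 100) / 7 ^ (n - (j + 1)) := by
    field_simp
  have e2 : ((2 : ℝ) / 5 / 7 + 14 / 100) / 7 ^ (n - (j + 1)) ≤ 1 / 5 / 7 ^ (n - (j + 1)) :=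
    div_le_div_of_nonneg_right (by norm_num) hX.le
  linarith

/-! ## §3 The parametric core bound -/

section Core

variable (r Q L : ℕ → ℕ) (G : ℕ → ℝ → ℝ → ℝ)

/-- **Core bound for a certified box `(J, α, β, lo)`.**  On a sub-tangent `(s,t)` with
`(1−t)·3·7^(J+M) ≤ 7/100`: `(1/20)^J·((s−1)/5)·lo^M < 1` — else the certified lower bounds,
transported through stages `0…J−1` (multiplier `≥ 1/20`) and `J…J+M−1` (multiplier `≥ lo` on the
box), force `γ − m ≥ 4/5 > 7/10` at stage `J+M`, violating the cap. [cite: Pan1984, Thm. 17.1;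
LottiRomani1983, Thm. 3.1, Prop. 4.1] -/
theorem core_bound_of_cert
    (h0r : r 0 = 6) (h0Q : Q 0 = 2) (h0L : L 0 = 2)
    (hG0 : ∀ s t : ℝ, G 0 s t = (2 : ℝ) ^ s)
    (hL : ∀ j, L (j + 1) = (Q j + L j) ^ 7 - Q j ^ 7) (hr : ∀ j, r (j + 1) = r j ^ 7 + L (j + 1))
    (hQ : ∀ j, Q (j + 1) = r j ^ 7 - L (j + 1))
    (hG : ∀ j (s t : ℝ), G (j + 1) s t =
      (((Q j : ℕ) : ℝ) ^ t + G j s t) ^ 7 - (((Q j : ℕ) : ℝ) ^ t) ^ 7)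
    (hQ1 : ∀ j, 1 ≤ Q j) (hall : ∀ j, (Q j + L j) ^ 7 ≤ r j ^ 7)
    (hread : ∀ j (s t : ℝ), (∀ y : ℝ, 0 ≤ y → s + y * t ≤ omegaRect K 1 y 1) →
      G (j + 1) s t ≤ ((r j : ℕ) : ℝ) ^ 7)
    {α β lo : ℝ} (hα : (4 : ℝ) / 25 ≤ α) (hβ : β ≤ 19 / 100) (hlo1 : 1 ≤ lo) (hlo2 : lo ≤ 2)
    (hloc : lo * (1 + ((1 - α) ^ 7 - (1 - 2 * α) ^ 7)) ≤ 7 * (1 - β) ^ 6)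
    {J : ℕ} (hbox : ∀ j, J ≤ j → α ≤ (L j : ℝ) / r j ∧ (L j : ℝ) / r j ≤ β)
    {s t : ℝ} (ht1 : t ≤ 1) (hs1 : 1 ≤ s)
    (hst : ∀ y : ℝ, 0 ≤ y → s + y * t ≤ omegaRect K 1 y 1) (M : ℕ)
    (hu : (1 - t) * (3 * 7 ^ (J + M)) ≤ 7 / 100) :
    ((1 : ℝ) / 20) ^ J * ((s - 1) / 5) * lo ^ M < 1 := by
  by_contra HV
  push Not at HV
  have h0 : Q 0 + 2 * L 0 = r 0 := by rw [h0Q, h0L, h0r]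
  have hsum := anchor_add_two_mul_legs r Q L hL hr hQ hall h0
  have SF := fun j => virtual_normalForm K r Q L G hL hr hQ1 hall h0r hsum hG0 hG hread ht1 hst j
  have NF := fun j => step_normalForm r Q L hL hr hQ1 hsum j
  have MR := fun j => ratio_succ r Q L hL hr hQ1 hsum j
  have hu0 : 0 ≤ 1 - t := by linarith
  have hv0 : 0 ≤ s - 1 := by linarith
  have hlo0 : 0 ≤ lo := by linarith
  have hl0 : (0 : ℝ) < lo ^ M := by positivity
  have HV' : 1 / lo ^ M ≤ ((1 : ℝ) / 20) ^ J * ((s - 1) / 5) := by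
    rw [div_le_iff₀ hl0]; exact HV
  -- generic transport at stage j < J + M
  have STEP : ∀ j, j < J + M → ∀ lo' a b : ℝ, 0 ≤ lo' →
      lo' ≤ 7 * (1 - (L j : ℝ) / r j) ^ 6 /
        (1 + ((1 - (L j : ℝ) / r j) ^ 7 - (1 - 2 * ((L j : ℝ) / r j)) ^ 7)) →
      0 ≤ a - b → a - b ≤ G j s t / r j - (L j : ℝ) / r j →
      lo' * a - (lo' * b + 14 * ((1 - t) * (3 * 7 ^ j))) ≤
        G (j + 1) s t / r (j + 1) - (L (j + 1) : ℝ) / r (j + 1) := by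
    intro j hj lo' a b hlo0' hlolam hab hD
    obtain ⟨hθ0, hθρ, hdefj, hγ0, hcap, hrec⟩ := SF j
    obtain ⟨hrpos, hm0, hm1, -, -, -⟩ := NF j
    have hdef' : (1 - 2 * ((L j : ℝ) / r j)) - ((Q j : ℕ) : ℝ) ^ t / r j ≤ 1 / 100 :=
      le_trans hdefj (deficit_small hj hu0 hu)
    have hφpos : 0 < 1 + ((1 - (L j : ℝ) / r j) ^ 7 - (1 - 2 * ((L j : ℝ) / r j)) ^ 7) := by
      linarith [phi_nonneg hm0 hm1]
    have hm' : (L (j + 1) : ℝ) / r (j + 1) *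
        (1 + ((1 - (L j : ℝ) / r j) ^ 7 - (1 - 2 * ((L j : ℝ) / r j)) ^ 7)) =
        (1 - (L j : ℝ) / r j) ^ 7 - (1 - 2 * ((L j : ℝ) / r j)) ^ 7 := by
      rw [MR j]; exact div_mul_cancel₀ _ hφpos.ne'
    exact deviation_transport hm0 hm1 hγ0 hθ0 hθρ hdef' hcap hrec hm' hlo0' hlolam hab hD
      (by linarith)
  have LB : ∀ j, j < J + M → ∀ lo' : ℝ, lo' ≤ 2 →
      lo' * ((1 : ℝ) / 5 / 7 ^ (J + M - j)) + 14 * ((1 - t) * (3 * 7 ^ j)) ≤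
        (1 : ℝ) / 5 / 7 ^ (J + M - (j + 1)) :=
    fun j hj lo' hlo' => loss_budget_two hj hu hlo'
  -- b_j ≤ 1/7^M ≤ 1/lo^M ≤ (1/20)^J (v/5)
  have hbM : ∀ e : ℕ, M ≤ e → (1 : ℝ) / 5 / 7 ^ e ≤ 1 / lo ^ M := by
    intro e he
    have h1 : lo ^ M ≤ (7 : ℝ) ^ M := pow_le_pow_left₀ hlo0 (by linarith) M
    have h2 : (7 : ℝ) ^ M ≤ 7 ^ e := pow_le_pow_right₀ (by norm_num) he
    calc (1 : ℝ) / 5 / 7 ^ e ≤ 1 / 5 / lo ^ M := div_le_div_of_nonneg_left (by norm_num) hl0 (h1.trans h2)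
      _ ≤ 1 / lo ^ M := div_le_div_of_nonneg_right (by norm_num) hl0.le
  -- Phase 1: stages 0 … J with the crude multiplier 1/20
  have P1 : ∀ j, j ≤ J → ((1 : ℝ) / 20) ^ j * ((s - 1) / 5) - (1 : ℝ) / 5 / 7 ^ (J + M - j) ≤
      G j s t / r j - (L j : ℝ) / r j := by
    intro j
    induction j with
    | zero =>
      intro _
      have hI := initial_deviation r L G h0r h0L hG0 t hs1
      have hb : (0 : ℝ) ≤ 1 / 5 / 7 ^ (J + M - 0) := by positivity
      simp only [pow_zero, one_mul]
      linarith
    | succ j ih =>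
      intro hjJ
      have hj : j < J + M := by omega
      have ihj := ih (by omega)
      obtain ⟨hrpos, hm0, hm1, -, -, -⟩ := NF j
      have ha : ((1 : ℝ) / 20) ^ J * ((s - 1) / 5) ≤ ((1 : ℝ) / 20) ^ j * ((s - 1) / 5) := by
        apply mul_le_mul_of_nonneg_right _ (by linarith)
        exact pow_le_pow_of_le_one (by norm_num) (by norm_num) (by omega)
      have hb := hbM (J + M - j) (by omega)
      have hab : 0 ≤ ((1 : ℝ) / 20) ^ j * ((s - 1) / 5) - 1 / 5 / 7 ^ (J + M - j) := by
        linarith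
      have hS := STEP j hj (1 / 20) _ _ (by norm_num) (lambda_ge_crude hm0 hm1) hab ihj
      have hLB := LB j hj (1 / 20) (by norm_num)
      have e3 : ((1 : ℝ) / 20) ^ (j + 1) * ((s - 1) / 5) =
          1 / 20 * (((1 : ℝ) / 20) ^ j * ((s - 1) / 5)) := by
        rw [pow_succ]; ring
      rw [e3]
      linarith
  -- Phase 2: stages J … J+M with the box multiplier lo
  have P2 : ∀ k, k ≤ M →
      ((1 : ℝ) / 20) ^ J * ((s - 1) / 5) * lo ^ k - (1 : ℝ) / 5 / 7 ^ (M - k) ≤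
      G (J + k) s t / r (J + k) - (L (J + k) : ℝ) / r (J + k) := by
    intro k
    induction k with
    | zero =>
      intro _
      have := P1 J le_rfl
      simp only [pow_zero, mul_one, Nat.add_zero]
      have e : J + M - J = M - 0 := by omega
      rw [e] at this
      exact this
    | succ k ih =>
      intro hk
      have hj : J + k < J + M := by omega
      have ihk := ih (by omega)
      obtain ⟨hrpos, hm0, hm1, -, -, -⟩ := NF (J + k)
      have hbx := hbox (J + k) (by omega)
      have hlam := lambda_ge_of_cert hα hβ hlo0 hloc hbx.1 hbx.2
      have hsplit : lo ^ M = lo ^ k * lo ^ (M - k) := by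
        rw [← pow_add, Nat.add_sub_cancel' (by omega : k ≤ M)]
      have hlk : (0 : ℝ) < lo ^ k := by positivity
      have hlMk : (0 : ℝ) < lo ^ (M - k) := by positivity
      have ha : 1 / lo ^ (M - k) ≤ ((1 : ℝ) / 20) ^ J * ((s - 1) / 5) * lo ^ k := by
        rw [div_le_iff₀ hlMk, mul_assoc, ← hsplit]
        exact HV
      have hb : (1 : ℝ) / 5 / 7 ^ (M - k) ≤ 1 / lo ^ (M - k) := by
        have h1 : lo ^ (M - k) ≤ (7 : ℝ) ^ (M - k) := pow_le_pow_left₀ hlo0 (by linarith) _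
        calc (1 : ℝ) / 5 / 7 ^ (M - k) ≤ 1 / 5 / lo ^ (M - k) :=
              div_le_div_of_nonneg_left (by norm_num) hlMk h1
          _ ≤ 1 / lo ^ (M - k) := div_le_div_of_nonneg_right (by norm_num) hlMk.le
      have hab : 0 ≤ ((1 : ℝ) / 20) ^ J * ((s - 1) / 5) * lo ^ k - 1 / 5 / 7 ^ (M - k) := by
        linarith
      have hS := STEP (J + k) hj lo _ _ hlo0 hlam hab ihk
      have hLB := LB (J + k) hj lo hlo2
      have e1 : (J + M - (J + k)) = (M - k) := by omega
      have e2 : (J + M - (J + k + 1)) = (M - (k + 1)) := by omega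
      rw [e1, e2] at hLB
      have e3 : ((1 : ℝ) / 20) ^ J * ((s - 1) / 5) * lo ^ (k + 1) =
          lo * (((1 : ℝ) / 20) ^ J * ((s - 1) / 5) * lo ^ k) := by
        rw [pow_succ]; ring
      have e4 : J + (k + 1) = J + k + 1 := by omega
      rw [e3, e4]
      linarith
  -- the violation at stage J + M
  have hfin := P2 M le_rfl
  simp only [Nat.sub_self, pow_zero, div_one] at hfin
  obtain ⟨hθ0, hθρ, hdefj, hγ0, hcap, -⟩ := SF (J + M)
  obtain ⟨hrpos, hm0, hm1, -, -, -⟩ := NF (J + M)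
  have hdef7 : (1 - 2 * ((L (J + M) : ℝ) / r (J + M))) - ((Q (J + M) : ℕ) : ℝ) ^ t / r (J + M) ≤
      7 / 100 := le_trans hdefj hu
  have hviol := deviation_le_of_cap (γ := G (J + M) s t / r (J + M)) hθ0 (by linarith) hdef7 hcap
  linarith

end Core

end Summit.MatrixMultiplication.MatrixMultiplication.Theorems.FarEdgeDescentTowerBox

end
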